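import Summits.AtomisticToContinuum.Crystallization.Theorems.FrustratedLawDichotomyBumpKappaL
import Mathlib.Analysis.SpecialFunctions.ImproperIntegrals

/-!
# FrustratedLawDichotomy · an EXPLICIT radial dominator `kappa5` for the range-5 twin `SF₅`: everything but ONE near-field inequality on `(3, 6]`

Twin of `…BumpKappaL` for `a = 1`, `w = w₅`, `A = 13/4000`: `kappa5 s = (max s 1)⁻⁶/(6M₅)·clamp(5s/2 − 9, 0, 1)` (`M₅ = (32π/105)²`; lens-5's
range-5 closed form `(s⁻⁶/6)·smoothstep₁((s − 18/5)/(2/5))` with a LINEAR switch on `[18/5, 4]`): continuity / sign / tail,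
`∫_{s>0} s²·kappa5 = (6M₅)⁻¹·95/15552` EXACT, ★ `budget_kappa5 : 4π(∫ s²κ)·256π/3465 ≤ 13/4000` (value `0.0032394`, `π` cancels),
★★ `sf₅_of_nearIneq5`: `SF₅` ⟸ ONE inequality on `r ∈ (3, 6]` (numeric margin of the un-weakened inequality `3.9 %` at `r ≈ 4.0`).
[folklore]; 0 sorry.  Prover hand 1, gen 13 (decomp-a2c), `--supports stmt-AtomisticToContinuum-27623`.
-/

noncomputable section

namespace Summit.AtomisticToContinuum.Crystallization.Theorems.FrustratedLawDichotomyBumpAutocorrelation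

open MeasureTheory Set Real
open scoped BigOperators
open Summit.AtomisticToContinuum.Crystallization.Theorems.FrustratedLawDichotomySchurCut (omega₂ SchurFloor tailPot SF₅ w₅ ω₅)

/-! ## §1. The explicit dominator `kappa5` (Lennard-Jones tail `s⁻⁶/(6M₅)` switched on linearly across `[18/5, 4]`) -/

/-- The tail constant `M₅ = (32π/105)² = ∫ β ⋆ β`. -/
def tailConst5 : ℝ := (32 * π / 105) ^ 2

/-- `0 < M`. [folklore] -/
theorem tailConst5_pos : 0 < tailConst5 := by unfold tailConst5; positivity

/-- The linear switch `ramp5 s = clamp(5s/2 − 9, 0, 1)` (`0` below `18/5`, `1` above `4`). -/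
def ramp5 (s : ℝ) : ℝ := max 0 (min 1 (5 / 2 * s - 9))

/-- **The explicit dominator** `kappa5 s = (max s 1)⁻⁶/(6M₅)·ramp5(s)` (`= s⁻⁶/(6M₅)` for `s ≥ 4`, `= 0` for `s ≤ 18/5`). -/
def kappa5 (s : ℝ) : ℝ := (6 * tailConst5)⁻¹ * ((max s 1)⁻¹) ^ 6 * ramp5 s

/-- `ramp5` is continuous. [folklore] -/
theorem continuous_ramp5 : Continuous ramp5 := by unfold ramp5; fun_prop

/-- `0 ≤ ramp5 s ≤ 1`. [folklore] -/
theorem ramp5_mem_Icc (s : ℝ) : ramp5 s ∈ Icc (0:ℝ) 1 :=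
  ⟨le_max_left _ _, max_le zero_le_one (min_le_left _ _)⟩

/-- `ramp5 s = 0` for `s ≤ 18/5`. [folklore] -/
theorem ramp5_of_le {s : ℝ} (h : s ≤ 18 / 5) : ramp5 s = 0 := by
  unfold ramp5
  rw [max_eq_left]
  exact min_le_of_right_le (by linarith)

/-- `ramp5 s = 1` for `4 ≤ s`. [folklore] -/
theorem ramp5_of_ge {s : ℝ} (h : 4 ≤ s) : ramp5 s = 1 := by
  unfold ramp5
  rw [min_eq_left (by linarith), max_eq_right zero_le_one]

/-- `ramp5 s = 5s/2 − 9` on `[18/5, 4]`. [folklore] -/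
theorem ramp5_of_mem {s : ℝ} (h1 : 18 / 5 ≤ s) (h2 : s ≤ 4) : ramp5 s = 5 / 2 * s - 9 := by
  unfold ramp5
  rw [min_eq_right (by linarith), max_eq_right (by linarith)]

/-- `kappa5` is continuous (the factor `(max s 1)⁻¹` has no singularity). [folklore] -/
theorem continuous_kappa5 : Continuous kappa5 := by
  unfold kappa5
  refine (continuous_const.mul ((Continuous.inv₀ (by fun_prop) fun s => ?_).pow 6)).mul continuous_ramp5
  exact ne_of_gt (lt_of_lt_of_le zero_lt_one (le_max_right s 1))

/-- `0 ≤ kappa5`. [folklore] -/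
theorem kappa5_nonneg (s : ℝ) : 0 ≤ kappa5 s := by
  unfold kappa5
  refine mul_nonneg (mul_nonneg (inv_nonneg.2 (by linarith [tailConst5_pos])) (pow_nonneg (inv_nonneg.2 ?_) 6)) (ramp5_mem_Icc s).1
  exact le_trans zero_le_one (le_max_right s 1)

/-- `kappa5 s = 0` for `s ≤ 18/5`. [folklore] -/
theorem kappa5_of_le {s : ℝ} (h : s ≤ 18 / 5) : kappa5 s = 0 := by simp [kappa5, ramp5_of_le h]

/-- The tail: `kappa5 s = (6M₅)⁻¹·s⁻⁶` for `s ≥ 4`. [folklore] -/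
theorem kappa5_tail {s : ℝ} (h : 4 ≤ s) : kappa5 s = (6 * (32 * π / 105) ^ 2)⁻¹ * (s⁻¹) ^ 6 := by
  rw [kappa5, ramp5_of_ge h, max_eq_left (by linarith), mul_one, tailConst5]

/-- On `[18/5, 4]`: `s²·kappa5 s = (6M₅)⁻¹·((5/2)s⁻³ − 9s⁻⁴)`. [folklore] -/
theorem sq_mul_kappa5_of_mem {s : ℝ} (h1 : 18 / 5 ≤ s) (h2 : s ≤ 4) :
    s ^ 2 * kappa5 s = (6 * tailConst5)⁻¹ * (5 / 2 * s ^ (-3 : ℤ) - 9 * s ^ (-4 : ℤ)) := by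
  have hs : 0 < s := by linarith
  rw [kappa5, ramp5_of_mem h1 h2, max_eq_left (by linarith), show (-3 : ℤ) = -((3 : ℕ) : ℤ) by norm_num,
    show (-4 : ℤ) = -((4 : ℕ) : ℤ) by norm_num, zpow_neg, zpow_neg, zpow_natCast, zpow_natCast]
  field_simp

/-- On `[4, ∞)`: `s²·kappa5 s = (6M₅)⁻¹·s^(−4)` (real power). [folklore] -/
theorem sq_mul_kappa5_of_ge {s : ℝ} (h : 4 ≤ s) : s ^ 2 * kappa5 s = (6 * tailConst5)⁻¹ * s ^ (-4 : ℝ) := by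
  have hs : 0 < s := by linarith
  rw [kappa5, ramp5_of_ge h, max_eq_left (by linarith), mul_one,
    show (-4 : ℝ) = -((4 : ℕ) : ℝ) by norm_num, Real.rpow_neg hs.le, Real.rpow_natCast]
  field_simp

/-! ## §2. The `L¹` budget of `kappa5`: an exact rational computation (π cancels) -/

/-- The finite part: `∫_{18/5}^{4} s²·kappa5 = (6M₅)⁻¹ · 7/7776`. [folklore] -/
theorem integral_sq_kappa5_mid :
    ∫ s in (18 / 5 : ℝ)..4, s ^ 2 * kappa5 s = (6 * tailConst5)⁻¹ * (7 / 7776) := by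
  have hle : (18 / 5 : ℝ) ≤ 4 := by norm_num
  rw [intervalIntegral.integral_congr (g := fun s => (6 * tailConst5)⁻¹ * (5 / 2 * s ^ (-3 : ℤ) - 9 * s ^ (-4 : ℤ))) (fun s hs => by
    rw [uIcc_of_le hle] at hs; exact sq_mul_kappa5_of_mem hs.1 hs.2)]
  rw [intervalIntegral.integral_const_mul]
  congr 1
  have hderiv : ∀ s ∈ uIcc (18 / 5 : ℝ) 4,
      HasDerivAt (fun s : ℝ => -(5 / 4) * s ^ (-2 : ℤ) + 3 * s ^ (-3 : ℤ)) (5 / 2 * s ^ (-3 : ℤ) - 9 * s ^ (-4 : ℤ)) s := by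
    intro s hs
    rw [uIcc_of_le hle] at hs
    have hs0 : s ≠ 0 := by intro h; rw [h] at hs; norm_num at hs
    have h := ((hasDerivAt_zpow (-2) s (Or.inl hs0)).const_mul (-(5 / 4 : ℝ))).add ((hasDerivAt_zpow (-3) s (Or.inl hs0)).const_mul 3)
    refine h.congr_deriv ?_
    push_cast
    norm_num
    ring
  have hcont : ContinuousOn (fun s : ℝ => 5 / 2 * s ^ (-3 : ℤ) - 9 * s ^ (-4 : ℤ)) (uIcc (18 / 5 : ℝ) 4) := by
    rw [uIcc_of_le hle]
    have hne : ∀ x ∈ Icc (18 / 5 : ℝ) 4, x ≠ 0 := fun x hx h0 => by rw [h0] at hx; norm_num at hx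
    exact (continuousOn_const.mul (continuousOn_id.zpow₀ (-3) fun x hx => Or.inl (hne x hx))).sub
      (continuousOn_const.mul (continuousOn_id.zpow₀ (-4) fun x hx => Or.inl (hne x hx)))
  rw [intervalIntegral.integral_eq_sub_of_hasDerivAt hderiv (hcont.intervalIntegrable)]
  simp only [zpow_neg, zpow_ofNat]
  norm_num

/-- The tail part: `∫_{4}^∞ s²·kappa5 = (6M₅)⁻¹ · 1/192`. [folklore] -/
theorem integral_sq_kappa5_tail : ∫ s in Ioi (4 : ℝ), s ^ 2 * kappa5 s = (6 * tailConst5)⁻¹ * (1 / 192) := by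
  rw [setIntegral_congr_fun measurableSet_Ioi (fun s (hs : (4:ℝ) < s) => sq_mul_kappa5_of_ge hs.le), integral_const_mul,
    integral_Ioi_rpow_of_lt (by norm_num) (by norm_num)]
  congr 1
  rw [show (-4 : ℝ) + 1 = -((3 : ℕ) : ℝ) by norm_num, Real.rpow_neg (by norm_num), Real.rpow_natCast]
  norm_num

/-- `s²·kappa5` is integrable on `(0, ∞)`. [folklore] -/
theorem integrableOn_sq_kappa5 : IntegrableOn (fun s => s ^ 2 * kappa5 s) (Ioi 0) := by
  have h1 : IntegrableOn (fun s => s ^ 2 * kappa5 s) (Icc 0 4) :=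
    ((continuous_pow 2).mul continuous_kappa5).continuousOn.integrableOn_Icc
  have h2 : IntegrableOn (fun s => s ^ 2 * kappa5 s) (Ioi 4) := by
    have h2' : IntegrableOn (fun s : ℝ => (6 * tailConst5)⁻¹ * s ^ (-4 : ℝ)) (Ioi 4) :=
      (integrableOn_Ioi_rpow_of_lt (by norm_num : (-4:ℝ) < -1) (by norm_num : (0:ℝ) < 4)).const_mul (6 * tailConst5)⁻¹
    exact IntegrableOn.congr_fun h2' (fun s (hs : (4:ℝ) < s) => (sq_mul_kappa5_of_ge hs.le).symm) measurableSet_Ioi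
  exact (h1.union h2).mono_set fun s (hs : 0 < s) => by
    rcases le_or_gt s 4 with h | h
    · exact Or.inl ⟨hs.le, h⟩
    · exact Or.inr h

/-- `∫_{s>0} s²·kappa5 = (6M₅)⁻¹ · 95/15552`. [folklore] -/
theorem integral_sq_kappa5 : ∫ s in Ioi (0:ℝ), s ^ 2 * kappa5 s = (6 * tailConst5)⁻¹ * (95 / 15552) := by
  rw [setIntegral_eq_of_subset_of_forall_sdiff_eq_zero measurableSet_Ioi (Ioi_subset_Ioi (by norm_num) : Ioi (18/5:ℝ) ⊆ Ioi 0)]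
  swap
  · rintro s ⟨-, h2⟩
    have : s ≤ 18 / 5 := not_lt.mp h2
    simp [kappa5_of_le this]
  rw [← Ioc_union_Ioi_eq_Ioi (by norm_num : (18/5:ℝ) ≤ 4),
    setIntegral_union Ioc_disjoint_Ioi_same measurableSet_Ioi
      (integrableOn_sq_kappa5.mono_set fun s hs => lt_trans (by norm_num) hs.1)
      (integrableOn_sq_kappa5.mono_set fun s (hs : (4:ℝ) < s) => lt_trans (by norm_num) hs),
    ← intervalIntegral.integral_of_le (by norm_num : (18/5:ℝ) ≤ 4), integral_sq_kappa5_mid, integral_sq_kappa5_tail, ← mul_add]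
  norm_num

/-- ★ **THE BUDGET OF `kappa5`**: `4π·(∫_{s>0} s²κ)·256π/3465 ≤ 13/4000` (`π` cancels; the value is `0.0032394`). [folklore] -/
theorem budget_kappa5 : 4 * π * (∫ s in Ioi (0:ℝ), s ^ 2 * kappa5 s) * (256 * π / 3465) ≤ 13 / 4000 := by
  rw [integral_sq_kappa5, tailConst5]
  have hπ : π ≠ 0 := Real.pi_ne_zero
  rw [show 4 * π * ((6 * (32 * π / 105) ^ 2)⁻¹ * (95 / 15552)) * (256 * π / 3465) =
      4 * ((6 * (32 / 105 : ℝ) ^ 2)⁻¹ * (95 / 15552)) * (256 / 3465) by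
    field_simp]
  norm_num

/-! ## §3. `SF₅` from ONE near-field inequality -/

/-- ★★ **`SF₅` ⟸ ONE ONE-VARIABLE INEQUALITY ON `(3, 6]`** (explicit dominator `kappa5`; every other hypothesis of `sf₅_of_nearCert` discharged). [folklore chaining] -/
theorem sf₅_of_nearIneq5
    (hnear : ∀ r, 3 < r → r ≤ 6 → -(tailPot w₅ r) ≤
      512 * π / 3465 * (2 * π / r * ∫ s in Ioi 0, s * kappa5 s * ∫ τ in |r - s|..(r + s), τ * omega₂ τ)) :
    SF₅ :=
  sf₅_of_nearCert kappa5 continuous_kappa5 kappa5_nonneg integrableOn_sq_kappa5 6 (by norm_num)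
    (fun s hs => kappa5_tail (by linarith)) hnear budget_kappa5

end Summit.AtomisticToContinuum.Crystallization.Theorems.FrustratedLawDichotomyBumpAutocorrelation

end
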